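import Mathlib.Data.Finset.Card
import Literature.Computability.MetaComplexity.ResLin
import Literature.Computability.MetaComplexity.ResLinProofs
import Literature.Computability.MetaComplexity.ResLinWidth
import Literature.Computability.MetaComplexity.RevResLin
import Literature.Computability.MetaComplexity.ResLinSpace
import Literature.Computability.MetaComplexity.ResLinWinningStrategy
import Literature.Computability.MetaComplexity.ResLinResolventImplication
import HarnessLib

/-!
# The space–width relation for resolution over parities Res(⊕)

Gryaznov–Ovcharov–Riazanov [ACM ToCT 2024, Thm 6]: *Let `φ` be an unsatisfiable linear `r`-CNF
formula. Then `Space(φ) ≥ Width(φ) − r − 1`* — the Res(⊕) analogue of the Atserias–Dalmau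
space–width relation for resolution. Here `Space` is the clause space of configuration-style
Res(⊕) refutations (`Literature.Computability.MetaComplexity.IsResLinSpaceRefutation`,
`resLinClauseSpace`) and `Width` is the minimal, over line-based Res(⊕) refutations (resolution
rule + SEMANTIC weakening, `IsResLinRefutation`), of the maximal number of linear literals of a
line. We prove it for ordinary CNFs `φ` (the case the tree needs) in the form

* `le_resLinClauseSpace_of_forall_lt_card` — if every clause of `φ` has at most `r ≤ k` literals
  and EVERY Res(⊕) refutation of `φ` has a line with more than `k` linear literals, then every
  configuration-style Res(⊕) refutation of `φ` has clause space at least `k + 2 − r`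

(GOR's statement with `Width(φ) = k + 1` reads `≥ k − r`; the two extra units come from treating
the semantic weakening rule directly instead of through the syntactic simulation of
[GOR 2024, Lemma 8], see below), with the corollaries `le_resLinClauseSpace_of_forall_lt_resLinWidth`
(hypothesis on the RANK of lines, `resLinWidth`, the tree's width notion: rank `≤` number of
literals) and `le_minResLinClauseSpace_of_forall_lt_card` (`ℕ∞` form).

## Proof

[GOR 2024, §4] in two steps.

1. `isWinningStrategy_of_forall_lt_card` (`ResLinWinningStrategy.lean`) = [GOR, Lemma 5]: if no
   refutation has all its lines of literal-width `≤ k` (`k ≥ r`), the systems with at most `k`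
   equations every width-`k`-derivable clause of which is satisfied by some solution form a
   `k`-winning strategy (`IsWinningStrategy`).
2. `IsWinningStrategy.lt_resLinClauseSpace` = [GOR, Lemmas 9–10], proved DIRECTLY for the semantic
   weakening rule: along a configuration-style refutation of clause space `≤ s` we maintain a map
   assigning to every clause `C` in memory ONE linear equation `e_C` with `e_C ⊨ C`, the equations
   `{e_C}` forming a system of the strategy. Download uses property (4) once per literal and then
   (2); erasure and weakening are free; for a resolution step `C ∨ (f=0), D ∨ (f=1) ⊢ C ∨ D` the
   lemma `exists_imp_resolvent_of_imp` (`ResLinResolventImplication.lean`) shows that one of `e₁`,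
   `e₂`, `e₁ + e₂` implies `C ∨ D` (an `𝔽₂` affine-combination argument on three falsifying
   assignments). The empty clause can
   carry no such equation. GOR instead first make all weakenings syntactic ([GOR, Lemma 8], at the
   price of one memory cell) — the only deviation from the printed proof, and the source of the
   constant `k + 2 − r` instead of `k − r`.

## References

* S. Gryaznov, S. Ovcharov, A. Riazanov, *Resolution over linear equations: combinatorial games
  for tree-like size and space*, ACM ToCT 16(3) (2024), §4, Lemmas 5, 6, 9, 10, Theorem 6
  [GryaznovOvcharovRiazanov2024].
* A. Atserias, V. Dalmau, *A combinatorial characterization of resolution width*, JCSS 74 (2008),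
  Thm 3 / Lemma 5 (the resolution case) [AtseriasDalmau2008].
-/

namespace Literature.Computability.MetaComplexity

open _root_.Computability Complexity Finset

/-! ### Clause space from a winning strategy (GOR Lemmas 9–10, semantic weakening directly) -/

section Strategy

variable {φ : CNF ℕ} {K : ℕ} {H : Set (Finset LinLit)}

/-- Download helper: inside a winning strategy a system extends, one variable at a time, by
equations `xᵥ = aᵥ` for all the variables of a list of literals, as long as the budget `K` allows.
[Gryaznov–Ovcharov–Riazanov 2024, proof of Lemma 9 (download case)]
[cite: GryaznovOvcharovRiazanov2024, Lemma 9] -/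
theorem IsWinningStrategy.exists_extension (hH : IsWinningStrategy φ K H) :
    ∀ (L : List (Literal ℕ)) (G : Finset LinLit), G ∈ H → G.card + L.length ≤ K →
      ∃ G' ∈ H, G ⊆ G' ∧ ∀ l ∈ L, ∃ a : Bool, (({l.1} : Finset ℕ), a) ∈ G' := by
  intro L
  induction L with
  | nil =>
      intro G hG _
      exact ⟨G, hG, Finset.Subset.refl _, by simp⟩
  | cons l L ih =>
      intro G hG hcard
      simp only [List.length_cons] at hcard
      obtain ⟨a, ha⟩ := hH.exists_insert_mem G hG (by omega) {l.1}
      obtain ⟨G', hG', hsub, hall⟩ := ih (insert (({l.1} : Finset ℕ), a) G) ha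
        (by have := Finset.card_insert_le (({l.1} : Finset ℕ), a) G; omega)
      refine ⟨G', hG', (Finset.subset_insert _ _).trans hsub, ?_⟩
      intro l' hl'
      rcases List.mem_cons.1 hl' with rfl | hl'
      · exact ⟨a, hsub (Finset.mem_insert_self _ _)⟩
      · exact hall l' hl'

/-- Bookkeeping helper: the invariant "`e` assigns to every clause in memory ONE equation implying
it, and the assigned equations form a system of the strategy" survives adding a clause `Q` with a
chosen equation `E ⊨ Q`, provided the enlarged system is in the strategy.
[Gryaznov–Ovcharov–Riazanov 2024, proof of Lemma 9 (the invariant)]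
[cite: GryaznovOvcharovRiazanov2024, Lemma 9] -/
theorem exists_tracking_insert {M : Finset LinClause} {e : LinClause → LinLit}
    (he : ∀ C ∈ M, ∀ σ : ℕ → Bool, LinLit.eval σ (e C) = true → C.eval σ = true)
    (hM : M.image e ∈ H) {Q : LinClause} {E : LinLit}
    (hE : ∀ σ : ℕ → Bool, LinLit.eval σ E = true → Q.eval σ = true)
    (hins : insert E (M.image e) ∈ H) :
    ∃ e' : LinClause → LinLit,
      (∀ C ∈ insert Q M, ∀ σ : ℕ → Bool, LinLit.eval σ (e' C) = true → C.eval σ = true) ∧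
      (insert Q M).image e' ∈ H := by
  classical
  by_cases hQ : Q ∈ M
  · rw [Finset.insert_eq_of_mem hQ]
    exact ⟨e, he, hM⟩
  refine ⟨Function.update e Q E, ?_, ?_⟩
  · intro C hC σ hσ
    rcases Finset.mem_insert.1 hC with rfl | hCM
    · rw [Function.update_self] at hσ
      exact hE σ hσ
    · have hne : C ≠ Q := by
        rintro rfl
        exact hQ hCM
      rw [Function.update_of_ne hne] at hσ
      exact he C hCM σ hσ
  · have himage : (insert Q M).image (Function.update e Q E) = insert E (M.image e) := by
      rw [Finset.image_insert, Function.update_self]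
      congr 1
      refine Finset.image_congr fun C hC => Function.update_of_ne ?_ _ _
      rintro rfl
      exact hQ (Finset.mem_coe.1 hC)
    rw [himage]
    exact hins

/-- Cardinality helper: tracking one more clause costs at most one more equation. [folklore] -/
private theorem card_insert_image_le {M : Finset LinClause} {e : LinClause → LinLit}
    {Q : LinClause} {E : LinLit} (hQ : Q ∉ M) :
    (insert E (M.image e)).card ≤ (insert Q M).card := by
  classical
  calc (insert E (M.image e)).card ≤ (M.image e).card + 1 := Finset.card_insert_le _ _
    _ ≤ M.card + 1 := Nat.add_le_add_right Finset.card_image_le 1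
    _ = (insert Q M).card := (Finset.card_insert_of_notMem hQ).symm

/-- ONE MEMORY OPERATION preserves the invariant of [GOR 2024, Lemma 9], in the one-equation-
per-clause form that tolerates the semantic weakening rule: if every clause of the memory `M`
carries an equation implying it, the equations forming a system of the `K`-winning strategy, and
`M → M'` is a download (`φ` an `r`-CNF, `|M'| + r ≤ K + 1`), an erasure, a resolution inference
(three-candidates lemma) or a semantic weakening (`|M'| ≤ K`), then the same holds for `M'`.
[cite: GryaznovOvcharovRiazanov2024, Lemma 9] -/
theorem IsWinningStrategy.exists_tracking_step (hH : IsWinningStrategy φ K H) {r s : ℕ}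
    (hφ : φ.IsWidthLE r) (hsr : s + r ≤ K + 1) (hsK : s ≤ K) {M M' : Finset LinClause}
    (hstep : ResLinSpaceStep φ M M') (hM' : M'.card ≤ s) {e : LinClause → LinLit}
    (he : ∀ C ∈ M, ∀ σ : ℕ → Bool, LinLit.eval σ (e C) = true → C.eval σ = true)
    (hM : M.image e ∈ H) :
    ∃ e' : LinClause → LinLit,
      (∀ C ∈ M', ∀ σ : ℕ → Bool, LinLit.eval σ (e' C) = true → C.eval σ = true) ∧
      M'.image e' ∈ H := by
  classical
  cases hstep with
  | download c hc =>
      by_cases hQ : Clause.toLinClause c ∈ M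
      · rw [Finset.insert_eq_of_mem hQ]
        exact ⟨e, he, hM⟩
      have hcardM : M.card + 1 ≤ s := by
        rw [← Finset.card_insert_of_notMem hQ]; exact hM'
      -- extend the tracked system by the variables of `c` (property 4, `|c| ≤ r` times)
      have hbudget : (M.image e).card + c.length ≤ K := by
        have h1 : (M.image e).card ≤ M.card := Finset.card_image_le
        have h2 : c.length ≤ r := hφ c hc
        omega
      obtain ⟨G', hG', hsub, hall⟩ := hH.exists_extension c (M.image e) hM hbudget
      -- property 2: some solution of the extended system satisfies `c`, i.e. one of its literals
      obtain ⟨σ, hσG', hσc⟩ := hH.exists_sat G' hG' c hc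
      rw [eval_toLinClause] at hσc
      obtain ⟨l, hl, hltrue⟩ := List.any_eq_true.1 hσc
      obtain ⟨a, ha⟩ := hall l hl
      have haeq : a = l.2 := by
        have h1 := hσG' _ ha
        rw [LinLit.eval_singleton] at h1
        simp only [Literal.eval, beq_iff_eq] at hltrue h1
        exact h1.symm.trans hltrue
      have hmem : l.toLinLit ∈ G' := by
        rw [show l.toLinLit = (({l.1} : Finset ℕ), a) by rw [haeq]; rfl]
        exact ha
      refine exists_tracking_insert he hM (Q := Clause.toLinClause c) (E := l.toLinLit) ?_ ?_
      · intro τ hτ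
        refine linClause_eval_eq_true_of_mem ?_ hτ
        unfold Clause.toLinClause
        rw [List.mem_toFinset]
        exact List.mem_map.2 ⟨l, hl, rfl⟩
      · refine hH.mem_of_imp G' hG' _ (fun τ hτ x hx => ?_) ?_
        · rcases Finset.mem_insert.1 hx with rfl | hx
          · exact hτ _ hmem
          · exact hτ _ (hsub hx)
        · exact (card_insert_image_le hQ).trans (hM'.trans hsK)
  | erase C hC =>
      refine ⟨e, fun D hD => he D (Finset.mem_of_mem_erase hD), ?_⟩
      refine hH.mem_of_imp (M.image e) hM _ (fun σ hσ x hx => hσ x ?_) ?_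
      · exact Finset.image_subset_image (Finset.erase_subset _ _) hx
      · exact Finset.card_image_le.trans (hM'.trans hsK)
  | resolve C D f hC hD =>
      by_cases hQ : C ∪ D ∈ M
      · rw [Finset.insert_eq_of_mem hQ]
        exact ⟨e, he, hM⟩
      have h3 := exists_imp_resolvent_of_imp (e (insert (f, false) C)).1 (e (insert (f, true) D)).1
        f (e (insert (f, false) C)).2 (e (insert (f, true) D)).2 C D (he _ hC) (he _ hD)
      -- one of the three candidates, each implied by the tracked system
      have key : ∃ E : LinLit, (∀ σ : ℕ → Bool, LinLit.eval σ E = true → (C ∪ D).eval σ = true) ∧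
          (∀ σ : ℕ → Bool, (∀ x ∈ M.image e, LinLit.eval σ x = true) → LinLit.eval σ E = true) := by
        rcases h3 with h | h | h
        · exact ⟨_, h, fun σ hσ => hσ _ (Finset.mem_image_of_mem e hC)⟩
        · exact ⟨_, h, fun σ hσ => hσ _ (Finset.mem_image_of_mem e hD)⟩
        · exact ⟨_, h, fun σ hσ => linLit_eval_symmDiff σ _ _ _ _
            (hσ _ (Finset.mem_image_of_mem e hC)) (hσ _ (Finset.mem_image_of_mem e hD))⟩
      obtain ⟨E, hE, himp⟩ := key
      refine exists_tracking_insert he hM hE ?_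
      refine hH.mem_of_imp (M.image e) hM _ (fun σ hσ x hx => ?_) ?_
      · rcases Finset.mem_insert.1 hx with rfl | hx
        · exact himp σ hσ
        · exact hσ x hx
      · exact (card_insert_image_le hQ).trans (hM'.trans hsK)
  | weaken C D hC h =>
      by_cases hQ : D ∈ M
      · rw [Finset.insert_eq_of_mem hQ]
        exact ⟨e, he, hM⟩
      refine exists_tracking_insert he hM (E := e C) (fun σ hσ => h σ (he C hC σ hσ)) ?_
      refine hH.mem_of_imp (M.image e) hM _ (fun σ hσ x hx => ?_) ?_
      · rcases Finset.mem_insert.1 hx with rfl | hx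
        · exact hσ _ (Finset.mem_image_of_mem e hC)
        · exact hσ x hx
      · exact (card_insert_image_le hQ).trans (hM'.trans hsK)

/-- **Clause space from a winning strategy** [Gryaznov–Ovcharov–Riazanov 2024, Lemmas 9–10], for
the SEMANTIC weakening rule directly: if the `r`-CNF `φ ≠ []` has a `K`-winning strategy and
`s + r ≤ K + 1`, `s ≤ K`, then every configuration-style Res(⊕) refutation of `φ` has, at some
moment, more than `s` linear clauses in memory. (The invariant: one equation per clause in memory
implying it, the equations forming a system of the strategy; the empty clause admits no such
equation.) [cite: GryaznovOvcharovRiazanov2024, Lemma 10] -/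
theorem IsWinningStrategy.lt_resLinClauseSpace (hH : IsWinningStrategy φ K H) {r s : ℕ}
    (hφ : φ.IsWidthLE r) (hne : φ ≠ []) (hsr : s + r ≤ K + 1) (hsK : s ≤ K)
    {π : List (Finset LinClause)} (hπ : IsResLinSpaceRefutation φ π) :
    s < resLinClauseSpace π := by
  classical
  by_contra hlt
  push Not at hlt
  have hall : ∀ M ∈ π, M.card ≤ s := resLinClauseSpace_le_iff.1 hlt
  obtain ⟨hπne, hhead, hchain, hlast⟩ := hπ
  -- restrict the chain relation to steps inside `π` (targets have at most `s` clauses)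
  have hchain' : List.IsChain (fun M M' => ResLinSpaceStep φ M M' ∧ M'.card ≤ s) π :=
    hchain.imp_of_mem_imp fun M M' _ hM' hst => ⟨hst, hall M' hM'⟩
  have key : ∀ M ∈ π, ∃ e : LinClause → LinLit,
      (∀ C ∈ M, ∀ σ : ℕ → Bool, LinLit.eval σ (e C) = true → C.eval σ = true) ∧
        M.image e ∈ H := by
    refine hchain'.induction (fun M => ∃ e : LinClause → LinLit,
      (∀ C ∈ M, ∀ σ : ℕ → Bool, LinLit.eval σ (e C) = true → C.eval σ = true) ∧
        M.image e ∈ H) π ?_ ?_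
    · rintro M M' ⟨hst, hM'⟩ ⟨e, he, hM⟩
      exact hH.exists_tracking_step hφ hsr hsK hst hM' he hM
    · intro _
      rw [hhead]
      refine ⟨fun _ => ((∅ : Finset ℕ), false), by simp, ?_⟩
      rw [Finset.image_empty]
      exact hH.empty_mem
  obtain ⟨e, he, hmem⟩ := key _ (List.getLast_mem hπne)
  obtain ⟨c, hc⟩ := List.exists_mem_of_ne_nil φ hne
  obtain ⟨σ, hσ, -⟩ := hH.exists_sat _ hmem c hc
  have := he ∅ hlast σ (hσ _ (Finset.mem_image_of_mem e hlast))
  simp at this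

end Strategy

/-! ### The space–width relation (GOR Theorem 6) -/

/-- A CNF containing the empty clause has the one-line Res(⊕) refutation `[∅]` (helper).
[Itsykson–Sokolov 2020, §2] [cite: ItsyksonSokolov2020, §2] -/
private theorem isResLinRefutation_singleton_of_nil_mem {φ : CNF ℕ} (h : ([] : Clause ℕ) ∈ φ) :
    IsResLinRefutation φ [⟨∅, .initial⟩] := by
  refine ⟨?_, ⟨∅, .initial⟩, by simp, rfl⟩
  intro i hi
  have hi0 : i = 0 := by simp only [List.length_singleton] at hi; omega
  subst hi0
  exact IsValidResLinLine.of_initial rfl h (by simp [Clause.toLinClause])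

/-- **The space–width relation for Res(⊕)** [Gryaznov–Ovcharov–Riazanov, ACM ToCT 2024, Thm 6:
"Let `φ` be an unsatisfiable linear `r`-CNF formula. Then `Space(φ) ≥ Width(φ) − r − 1`"], for
CNFs and with the semantic weakening rule treated directly: if every clause of `φ` has at most
`r ≤ k` literals and every Res(⊕) refutation of `φ` has a line with MORE than `k` linear literals
(i.e. `Width(φ) ≥ k + 1`), then every configuration-style Res(⊕) refutation of `φ` has clause space
at least `k + 2 − r`. [cite: GryaznovOvcharovRiazanov2024, Theorem 6] -/
theorem le_resLinClauseSpace_of_forall_lt_card {φ : CNF ℕ} {r k : ℕ} (hφ : φ.IsWidthLE r)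
    (hrk : r ≤ k)
    (hwide : ∀ π : List ResLinLine, IsResLinRefutation φ π → ∃ l ∈ π, k < l.clause.card)
    {π : List (Finset LinClause)} (hπ : IsResLinSpaceRefutation φ π) :
    k + 2 - r ≤ resLinClauseSpace π := by
  have hunsat := not_satisfiable_of_isResLinSpaceRefutation hπ
  have hne : φ ≠ [] := by
    rintro rfl
    exact hunsat ⟨fun _ => false, by simp [CNF.eval]⟩
  rcases Nat.eq_zero_or_pos r with rfl | hr
  · -- `r = 0`: `φ` consists of empty clauses, refuted in one line of width `0 ≤ k`
    exfalso
    obtain ⟨c, hc⟩ := List.exists_mem_of_ne_nil φ hne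
    have hc0 : c = [] := List.eq_nil_of_length_eq_zero (Nat.le_zero.1 (hφ c hc))
    subst hc0
    obtain ⟨l, hl, hkl⟩ := hwide _ (isResLinRefutation_singleton_of_nil_mem hc)
    rw [List.mem_singleton] at hl
    subst hl
    simp at hkl
  · have hH := isWinningStrategy_of_forall_lt_card hφ hrk hwide
    have h := hH.lt_resLinClauseSpace (s := k + 1 - r) hφ hne (by omega) (by omega) hπ
    omega

/-- The same in the tree's RANK vocabulary (`resLinWidth` = maximal `linClauseRank` of a line;
rank `≤` number of literals, `linClauseRank_le_card`): if every clause of `φ` has at most `r ≤ k`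
literals and every Res(⊕) refutation of `φ` has a line of rank `> k` (`k < resLinWidth π`), then
every configuration-style refutation has clause space `≥ k + 2 − r`.
[Gryaznov–Ovcharov–Riazanov 2024, Thm 6 (corollary)] [cite: GryaznovOvcharovRiazanov2024, Theorem 6] -/
theorem le_resLinClauseSpace_of_forall_lt_resLinWidth {φ : CNF ℕ} {r k : ℕ} (hφ : φ.IsWidthLE r)
    (hrk : r ≤ k)
    (hwide : ∀ π : List ResLinLine, IsResLinRefutation φ π → k < resLinWidth π)
    {π : List (Finset LinClause)} (hπ : IsResLinSpaceRefutation φ π) :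
    k + 2 - r ≤ resLinClauseSpace π :=
  le_resLinClauseSpace_of_forall_lt_card hφ hrk (fun π' hπ' => by
    obtain ⟨l, hl, hkl⟩ := lt_resLinWidth_iff.1 (hwide π' hπ')
    exact ⟨l, hl, lt_of_lt_of_le hkl (linClauseRank_le_card _)⟩) hπ

/-- `ℕ∞` form: under the hypotheses of `le_resLinClauseSpace_of_forall_lt_card`,
`minResLinClauseSpace φ ≥ k + 2 − r`. [Gryaznov–Ovcharov–Riazanov 2024, Thm 6]
[cite: GryaznovOvcharovRiazanov2024, Theorem 6] -/
theorem le_minResLinClauseSpace_of_forall_lt_card {φ : CNF ℕ} {r k : ℕ} (hφ : φ.IsWidthLE r)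
    (hrk : r ≤ k)
    (hwide : ∀ π : List ResLinLine, IsResLinRefutation φ π → ∃ l ∈ π, k < l.clause.card) :
    ((k + 2 - r : ℕ) : ℕ∞) ≤ minResLinClauseSpace φ :=
  le_minResLinClauseSpace_iff.2 fun _ hπ => le_resLinClauseSpace_of_forall_lt_card hφ hrk hwide hπ

/-- `ℕ∞` form over the minimal rank: if `φ` is an `r`-CNF with `r ≤ k` and
`minResLinWidth φ ≥ k + 1`, then `minResLinClauseSpace φ ≥ k + 2 − r`.
[Gryaznov–Ovcharov–Riazanov 2024, Thm 6 (corollary)] [cite: GryaznovOvcharovRiazanov2024, Theorem 6] -/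
theorem le_minResLinClauseSpace_of_le_minResLinWidth {φ : CNF ℕ} {r k : ℕ} (hφ : φ.IsWidthLE r)
    (hrk : r ≤ k) (hw : ((k + 1 : ℕ) : ℕ∞) ≤ minResLinWidth φ) :
    ((k + 2 - r : ℕ) : ℕ∞) ≤ minResLinClauseSpace φ :=
  le_minResLinClauseSpace_iff.2 fun _ hπ =>
    le_resLinClauseSpace_of_forall_lt_resLinWidth hφ hrk
      (fun π' hπ' => Nat.lt_of_succ_le (le_minResLinWidth_iff.1 hw π' hπ')) hπ

end Literature.Computability.MetaComplexity
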